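import Summits.BirchSwinnertonDyer.BirchSwinnertonDyer.Theorems.ByReductionTypeAtTwoRankOneAtTwoOffBigImageOddLocalEngineCyclotomicBasis
import Summits.BirchSwinnertonDyer.BirchSwinnertonDyer.Theorems.GenusKolyvaginAtTwoEquivariantChebotarevAtTwoOfGaloisElement
import Literature.NumberTheory.EllipticCurves.HeegnerPointsKolyvaginConjugation
import HarnessLib

/-!
# Route `ByReductionTypeAtTwo`, crux `RankOneAtTwoOffBigImageOddLocal` (stmt-BirchSwinnertonDyer-23716), line
# `refined_kolyvagin_tamagawa_shift_at_two` — ENGINE PORT `c₀ ↦ h₀` (regular element), §F Steps C–H for a REGULAR element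

Lead prover `prover-cruxlead-stmt-BirchSwinnertonDyer-23716-g0` (2026-08-28), landing the crux-plan g6 ENGINE QUARRY
`Cruxes/RankOneAtTwoOffBigImageOddLocal/RefinedKolyvaginEngineG6.lean` (planner `cruxplan-…-23716-refined-kolyvag-9ff2fe475f-g6`, v4, 1631 lines,
rc 0 / 0 sorry; `Cruxes/` files are not importable, so the lead COPIES the proofs into `Theorems/` — card «LEAD QUICKSTART (g6)» Q2 #3 / Q4) as
`--supports stmt-BirchSwinnertonDyer-23716` helpers.  The engine port is kernel-closable item #3 of the pen's order (PEN-PICK-23716 ADD-4): replace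
complex conjugation `c₀` by a REGULAR element `h₀` (det `−1`, trace `0`, odd mod `2`) in the tree's equivariant-Čebotarev engine
`GenusExact.exists_kolyvaginPrime_gt_two_of_galoisElement`, so that Kolyvagin primes with LOSSLESS local Kummer maps exist on the `Δ > 0` cells of the
S₃-locus (where `ρ̄₂(c₀) = 1` loses the top bit — residual 24883), feeding the line's filtered stubs `…WithOn Φ_reg Ω` (card #7
`regular-frobenius-kolyvagin-primes-pos-disc`).  THIS FILE: §F — `exists_kolyvaginPrime_gt_two_of_galoisElement_regular`: the tree engine re-proved for an ARBITRARY `ρ ∈ Γ_K` with `h₀ := c₀ · res ρ` squaring to `1` on `E(ℚ̄)[2^M]` and inverting `μ_{2^M}`: for every bound a prime `ℓ` beyond it, `ℓ ∤ 2 N d_K`, inert in `K`, with a Frobenius acting on `E[2^M]` AS `h₀` and on `K` as `c₀`, `2^M ∣ ℓ + 1`, `2^M ∣ a_ℓ`, and the prescribed exact orders of the localised classes — modulo the tree's named Čebotarev fact `Automorphic.chebotarev_artinRep` (hypothesis).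

Statements and proofs are the quarry's VERBATIM (namespace moved to `…Theorems.OffBigImageOddLocalAtTwo.Engine`).  Nothing here proves the crux,
`BSDp W 2`, BSD or the summit; no registered stub is discharged (engine inputs only).  BSD is not proved.

Refs: [GrossLMS1991] §3 (3.1)–(3.3), §9; [McCallumLMS1991] §3; [SilvermanAEC2009] III.§1, III.§8 (Weil pairing), VII–VIII; Dokchitser–Dokchitser (2012);
Serre (1972) §5.3.
-/

set_option linter.dupNamespace false -- tree convention: `Summit.BirchSwinnertonDyer.BirchSwinnertonDyer.Theorems` (summit = sub-problem)
set_option autoImplicit false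

noncomputable section

namespace Summit.BirchSwinnertonDyer.BirchSwinnertonDyer.Theorems.OffBigImageOddLocalAtTwo.Engine

/-! ## §F  Steps C–H for a REGULAR element (card ENGINE-PORT MAP step E3, PROVED): the tree engine
`GenusExact.exists_kolyvaginPrime_gt_two_of_galoisElement` with `ρ ∈ Γ_{K(E[2^M])}` replaced by an arbitrary `ρ ∈ Γ_K`
such that `h₀ := c₀ · res ρ` squares to `1` on `E[2^M]` and inverts `μ_{2^M}`; output: a Kolyvagin prime `ℓ` whose
Frobenius acts on `E[2^M]` as `h₀` (not as `c₀`), `2^M ∣ ℓ + 1`, `2^M ∣ a_ℓ`, exact local orders.  What remains for the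
lead is E1 (produce `h₀` regular: §A–§C + Galois glue) and E2 (Step B: produce `ρ` with the exact twisted orders, §D). -/

section ChebotarevF

open scoped Classical Pointwise
open WeierstrassCurve NumberField IsDedekindDomain Field
open Literature.NumberTheory.GaloisRepresentations Literature.NumberTheory.EllipticCurves
open Literature.NumberTheory
open Rat.HeightOneSpectrum

universe u

variable {W : WeierstrassCurve ℚ} {K : Type u} [Field K] [NumberField K]

set_option maxHeartbeats 1600000 in
/-- **Steps C–H of McCallum's Cor. 3.2 at `2` for a REGULAR element `h₀ = c₀ · res ρ`** (the tree's
`GenusExact.exists_kolyvaginPrime_gt_two_of_galoisElement` — Step B's output `ρ` taken as a hypothesis — with the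
requirement `ρ ∈ Γ_{K(E[2^M])}` DROPPED: `ρ ∈ Γ_K` is arbitrary, subject to `h₀² = 1` on `E(ℚ̄)[2^M]` (`hsq`) and
`h₀` inverting `μ_{2^M}` (`hμ`, i.e. `det ρ_{2^M}(h₀) = -1`, §E `smul_eq_inv_of_det_repr_eq_neg_one`).  Conclusion: for
every `b` a prime `ℓ > b`, `ℓ ∤ 2 N d_K`, `(ℓ)` inert in `K`, a Frobenius `h` above `ℓ` acting on `E[2^M]` AS `h₀` and on
`K` as `c₀` (the regular replacement of `FrobEqFrobInfty`), `2^M ∣ ℓ + 1`, `2^M ∣ a_ℓ`, and `ord c_{i,λ} = 2^{N_i}` exactly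
at `λ ∋ ℓ`.  Proof = the tree proof verbatim (Čebotarev in `c₀ · res(ρ𝒩)`, inertness, the local criterion at `λ`),
except: `Frob_λ = τ' ∈ Γ_{K(E[2^M])}` now comes from `hsq` transported along `RatClosure.torsionEquiv` (instead of
`ρ ∈ Γ_{K(E[2^M])}`), and (3.3) comes from §E (instead of `…_of_frobEqFrobInfty`).  This is step E3 (Steps C–H) of the
card's ENGINE-PORT MAP, PROVED; Step B (E2: producing `ρ` with `hsq`, `hμ` and the exact orders) remains the lead's.
Conditional only on the displayed `hC : Automorphic.chebotarev_artinRep` (a tree THEOREM,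
`Automorphic.chebotarev_artinRep_of_galoisSide`). [cite: McCallumLMS1991, §3 Cor. 3.2 (proof, with Prop. 3.1)]
[cite: GrossLMS1991, §3 (3.1)–(3.3)] -/
theorem exists_kolyvaginPrime_gt_two_of_galoisElement_regular (hC : Automorphic.chebotarev_artinRep) {N : ℕ}
    [NeZero N] [W.IsElliptic] [W.IsGloballyMinimal] (hK : IsImaginaryQuadratic K) {M : ℕ}
    (hM : 1 ≤ M)
    {c₀ : absoluteGaloisGroup ℚ} (hc₀ : IsComplexConjugation (Rat.castHom ℝ) c₀)
    {c : K ≃ₐ[ℚ] K} (hc : c ≠ 1) {r : ℕ}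
    (cs : Fin r → galH1Torsion (W.baseChange K) ((2 ^ M : ℕ) : ℤ)) (Nv : Fin r → ℕ)
    {ρ : absoluteGaloisGroup K}
    (hsq : ∀ P : geomTorsion W ((2 ^ M : ℕ) : ℤ),
      (c₀ * absGaloisRestrict ℚ K ρ) • (c₀ * absGaloisRestrict ℚ K ρ) • P = P)
    (hμ : ∀ ζ : AlgebraicClosure ℚ, ζ ^ (2 ^ M) = 1 → (c₀ * absGaloisRestrict ℚ K ρ) • ζ = ζ⁻¹)
    (hρ : ∀ m ∈ evalKer (W.baseChange K) ((2 ^ M : ℕ) : ℤ) cs, ∀ i,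
        ((2 : ℤ) ^ Nv i) • h1Eval (W.baseChange K) ((2 ^ M : ℕ) : ℤ) (cs i)
            ((RatClosure.isLiftOfAut_absGaloisTransport_of_isImaginaryQuadratic hK hc hc₀).conjGalCMH
              (ρ * m) * (ρ * m)) = 0 ∧
          (Nv i ≠ 0 → ((2 : ℤ) ^ (Nv i - 1)) • h1Eval (W.baseChange K) ((2 ^ M : ℕ) : ℤ) (cs i)
            ((RatClosure.isLiftOfAut_absGaloisTransport_of_isImaginaryQuadratic hK hc hc₀).conjGalCMH
              (ρ * m) * (ρ * m)) ≠ 0))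
    (b : ℕ) :
    ∃ ℓ : ℕ, b < ℓ ∧ ℓ.Prime ∧ ¬ ℓ ∣ N ∧ ¬ ((ℓ : ℤ) ∣ NumberField.discr K) ∧ ℓ ≠ 2 ∧
      (Ideal.span {(ℓ : 𝓞 K)}).IsPrime ∧
      (∃ (v : HeightOneSpectrum (𝓞 ℚ)) (𝔓 : Ideal (absIntegers (𝓞 ℚ) ℚ)) (h : absoluteGaloisGroup ℚ),
        (ℓ : 𝓞 ℚ) ∈ v.asIdeal ∧ 𝔓 ∈ v.primesAbove ∧ IsArithFrobAt (𝓞 ℚ) h 𝔓 ∧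
        (∀ P : geomTorsion W ((2 ^ M : ℕ) : ℤ), h • P = (c₀ * absGaloisRestrict ℚ K ρ) • P) ∧
        ∀ (e : K →ₐ[ℚ] AlgebraicClosure ℚ) (x : K), h • e x = c₀ • e x) ∧
      2 ^ M ∣ ℓ + 1 ∧ ((2 : ℤ) ^ M) ∣ W.frobeniusTrace ℓ ∧
      ∀ i, ∀ v : HeightOneSpectrum (𝓞 K), (ℓ : 𝓞 K) ∈ v.asIdeal →
        (((2 : ℤ) ^ Nv i) • cs i ∈
            (W.baseChange K).torsionLocalKer (v.adicCompletion K) ((2 ^ M : ℕ) : ℤ) ∧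
          (Nv i ≠ 0 → ((2 : ℤ) ^ (Nv i - 1)) • cs i ∉
            (W.baseChange K).torsionLocalKer (v.adicCompletion K) ((2 ^ M : ℕ) : ℤ))) := by
  classical
  have hp : Nat.Prime 2 := Nat.prime_two
  haveI : Fact (Nat.Prime 2) := ⟨hp⟩
  haveI : Algebra.IsQuadraticExtension ℚ K := ⟨hK.1⟩
  haveI : IsTotallyComplex K := hK.2
  have hn0 : ((2 ^ M : ℕ) : ℤ) ≠ 0 := by exact_mod_cast pow_ne_zero M hp.ne_zero
  have h2n : (2 : ℤ) ∣ ((2 ^ M : ℕ) : ℤ) := by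
    rw [Nat.cast_pow]; exact dvd_pow_self _ (by omega)
  -- ### Step A: the involutive lift of complex conjugation and the free generator on `E(K̄)[2^M]`
  set t : AlgebraicClosure K ≃+* AlgebraicClosure K :=
    (absGaloisTransport (K := ℚ) (L := K) c₀).toRingEquiv with ht_def
  have ht : IsLiftOfAut c t :=
    RatClosure.isLiftOfAut_absGaloisTransport_of_isImaginaryQuadratic hK hc hc₀
  -- ### Step C: the finite exceptional set of places of `ℚ`
  have hbad : ((W.baseChange K).badPlaces (𝓞 K)).Finite :=
    (W.baseChange K).finite_badPlaces_holds (𝓞 K)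
  have hbad₀ : (W.badPlaces (𝓞 ℚ)).Finite := W.finite_badPlaces_holds (𝓞 ℚ)
  choose T hTfin hT using fun i ↦
    exists_finite_forall_mem_unramifiedKer (W.baseChange K) hn0 (cs i)
  set B : Finset ℕ := {2} ∪ N.primeFactors ∪ (NumberField.discr K).natAbs.primeFactors ∪
    Finset.range (b + 1) with hB
  set S₁ : Set (HeightOneSpectrum (𝓞 ℚ)) := {v | ∃ q ∈ B, q.Prime ∧ (q : 𝓞 ℚ) ∈ v.asIdeal}
    with hS₁
  set S₂ : Set (HeightOneSpectrum (𝓞 ℚ)) := {v | ¬ Algebra.IsUnramifiedIn (𝓞 K) v.asIdeal}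
    with hS₂
  set S₃ : Set (HeightOneSpectrum (𝓞 ℚ)) :=
    (fun w : HeightOneSpectrum (𝓞 K) ↦ w.under (𝓞 ℚ)) ''
      ((W.baseChange K).badPlaces (𝓞 K) ∪ ⋃ i, T i) with hS₃
  have hS₁fin : S₁.Finite := by
    have : S₁ ⊆ ⋃ q ∈ (B.filter Nat.Prime), {v | (q : 𝓞 ℚ) ∈ v.asIdeal} := by
      intro v ⟨q, hqB, hq, hqv⟩
      simp only [Set.mem_iUnion, Finset.mem_filter]
      exact ⟨q, ⟨hqB, hq⟩, hqv⟩
    refine Set.Finite.subset (Set.Finite.biUnion (Finset.finite_toSet _) fun q hq ↦ ?_) this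
    rw [Finset.coe_filter, Set.mem_setOf_eq] at hq
    have hsub : {v : HeightOneSpectrum (𝓞 ℚ) | (q : 𝓞 ℚ) ∈ v.asIdeal}.Subsingleton :=
      fun v hv v' hv' ↦ HeightOneSpectrum.eq_of_natCast_mem_rat hq.2 hv hv'
    exact hsub.finite
  have hS₂fin : S₂.Finite := finite_setOf_not_isUnramifiedIn ℚ K
  have hS₃fin : S₃.Finite :=
    (hbad.union (Set.finite_iUnion fun i ↦ hTfin i)).image _
  set S := S₁ ∪ S₂ ∪ S₃ ∪ W.badPlaces (𝓞 ℚ) with hSdef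
  have hSfin : S.Finite := ((hS₁fin.union hS₂fin).union hS₃fin).union hbad₀
  -- ### Step D: Čebotarev in `Γ_ℚ`: a Frobenius in the open set `c₀ · res(ρ 𝒩)`
  set 𝒩 := evalKer (W.baseChange K) ((2 ^ M : ℕ) : ℤ) cs with h𝒩
  have h𝒩open : IsOpen (𝒩 : Set (absoluteGaloisGroup K)) :=
    isOpen_evalKer (W.baseChange K) _ cs (isOpen_torsionFixing (W.baseChange K) hn0)
  set O : Set (absoluteGaloisGroup ℚ) :=
    (fun γ ↦ c₀ * γ) '' (absGaloisRestrict ℚ K '' ((fun m ↦ ρ * m) '' (𝒩 : Set _))) with hO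
  have hOopen : IsOpen O := by
    refine (Homeomorph.mulLeft c₀).isOpenMap _ (isOpenMap_absGaloisRestrict K _ ?_)
    exact (Homeomorph.mulLeft ρ).isOpenMap _ h𝒩open
  have hOne : O.Nonempty :=
    ⟨c₀ * absGaloisRestrict ℚ K (ρ * 1), _, ⟨_, ⟨1, 𝒩.one_mem, rfl⟩, rfl⟩, rfl⟩
  obtain ⟨γ, hγO, v, hvS, 𝔓₀, h𝔓₀, hγ⟩ :=
    (absoluteGaloisGroup.frobenius_dense hC ℚ S hSfin).inter_open_nonempty O hOopen hOne
  obtain ⟨_, ⟨_, ⟨m, hm, rfl⟩, rfl⟩, rfl⟩ := hγO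
  set g := ρ * m with hg
  have hmT : m ∈ torsionFixing (W.baseChange K) ((2 ^ M : ℕ) : ℤ) := hm.1
  -- `c₀ · res g` acts on `E(ℚ̄)[2^M]` as `h₀ := c₀ · res ρ` (since `m ∈ Γ_{K(E[2^M])}`)
  have key : ∀ X : geomTorsion W ((2 ^ M : ℕ) : ℤ),
      (c₀ * absGaloisRestrict ℚ K g) • X = (c₀ * absGaloisRestrict ℚ K ρ) • X := fun X ↦ by
    rw [hg, map_mul, ← mul_assoc, mul_smul (c₀ * _), absGaloisRestrict_smul_eq_of_mem_torsionFixing W hmT]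
  -- ### Step E: the rational prime `ℓ` under `v`
  obtain ⟨ℓ, hℓ, hℓv⟩ := exists_prime_natCast_mem v
  have hℓB : ℓ ∉ B := fun h ↦ hvS (Or.inl (Or.inl (Or.inl ⟨ℓ, h, hℓ, hℓv⟩)))
  simp only [hB, Finset.mem_union, Finset.mem_singleton, Nat.mem_primeFactors,
    Finset.mem_range, not_or] at hℓB
  obtain ⟨⟨⟨hℓp, hℓN⟩, hℓD⟩, hℓb⟩ := hℓB
  have hℓN' : ¬ ℓ ∣ N := fun h ↦ hℓN ⟨hℓ, h, NeZero.ne N⟩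
  have hℓD' : ¬ ((ℓ : ℤ) ∣ NumberField.discr K) := fun h ↦
    hℓD ⟨hℓ, Int.natAbs_dvd_natAbs.mpr h |>.trans (by simp), by
      simp [NumberField.discr_ne_zero]⟩
  have hbℓ : b < ℓ := by omega
  have hunr : Algebra.IsUnramifiedIn (𝓞 K) v.asIdeal := by
    by_contra h; exact hvS (Or.inl (Or.inl (Or.inr h)))
  have hvS₃ : v ∉ S₃ := fun h ↦ hvS (Or.inl (Or.inr h))
  have hgood₀ : W.HasGoodReductionAt v := by
    by_contra h; exact hvS (Or.inr h)
  -- ### Step F: `ℓ` is inert, with a Frobenius `τ' = g^τ g` over `K`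
  have hHi := index_range_absGaloisRestrict_eq_finrank ℚ K
  haveI hHn : ((absGaloisRestrict ℚ K).range).Normal :=
    Subgroup.normal_of_index_eq_two (hHi.trans hK.1)
  have hI := inertia_le_range_absGaloisRestrict_of_isUnramifiedIn (K := K) hunr h𝔓₀
  have hΦH : c₀ * absGaloisRestrict ℚ K g ∉ (absGaloisRestrict ℚ K).range := by
    intro h
    apply hc₀.not_mem_range_absGaloisRestrict (L := K) IsTotallyComplex.isComplex
    change c₀ ∈ ((absGaloisRestrict ℚ K).range : Set (absoluteGaloisGroup ℚ))
    have h' : c₀ = c₀ * absGaloisRestrict ℚ K g * (absGaloisRestrict ℚ K g)⁻¹ := by group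
    rw [SetLike.mem_coe, h']
    exact Subgroup.mul_mem _ h (Subgroup.inv_mem _ ⟨g, rfl⟩)
  obtain ⟨w, 𝔔, τ', hwv, hwuniq, -, h𝔔w, -, hτ', hresτ'⟩ :=
    exists_place_inert_of_not_mem_range (F := ℚ) (M := K) (hK.1 ▸ Nat.prime_two) hHn
      (hHi.trans rfl) hunr h𝔓₀ hI hγ hΦH
  -- `Frob_λ = τ'` fixes `E[2^M]`: `res τ' = (c₀ res g)²` acts as `h₀² = 1` (hypothesis `hsq`), transported along `E(ℚ̄)[n] ≃ E(K̄)[n]`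
  have hτ'T : τ' ∈ torsionFixing (W.baseChange K) ((2 ^ M : ℕ) : ℤ) := by
    refine (mem_torsionFixing_iff _ _).mpr fun Q ↦ ?_
    obtain ⟨P, rfl⟩ := (RatClosure.torsionEquiv (K := K) W ((2 ^ M : ℕ) : ℤ)).surjective Q
    rw [← RatClosure.torsionEquiv_smul, hresτ', hK.1, pow_two, mul_smul, key, key, hsq]
  rw [hK.1, sq_eq_absGaloisRestrict_conjGal_mul hc₀ ht g] at hresτ'
  have hτ'eq : τ' = ht.conjGalCMH g * g := absGaloisRestrict_injective ℚ K hresτ'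
  -- `ℓ ∈ w`, and `w` is the only place of `K` containing `ℓ`
  have hℓw : (ℓ : 𝓞 K) ∈ w.asIdeal := by
    have h1 : (ℓ : 𝓞 ℚ) ∈ (w.under (𝓞 ℚ)).asIdeal := by rw [hwv]; exact hℓv
    rw [HeightOneSpectrum.under_asIdeal, Ideal.under_def, Ideal.mem_comap, map_natCast] at h1
    exact h1
  have hwuniq' : ∀ w' : HeightOneSpectrum (𝓞 K), (ℓ : 𝓞 K) ∈ w'.asIdeal → w' = w := by
    intro w' hw'
    apply hwuniq
    apply HeightOneSpectrum.eq_of_natCast_mem_rat hℓ _ hℓv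
    rw [HeightOneSpectrum.under_asIdeal, Ideal.under_def, Ideal.mem_comap, map_natCast]
    exact hw'
  -- `(ℓ) = w` is prime
  have hspan : Ideal.span {(ℓ : 𝓞 K)} = w.asIdeal := by
    apply span_natCast_eq_of_unique hℓ w hwuniq'
    haveI : w.asIdeal.LiesOver v.asIdeal := ⟨by rw [← hwv]; rfl⟩
    have hmap : v.asIdeal.map (algebraMap (𝓞 ℚ) (𝓞 K)) = Ideal.span {(ℓ : 𝓞 K)} := by
      rw [← span_natCast_rat_eq hℓ hℓv, Ideal.map_span, Set.image_singleton, map_natCast]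
    have hne : v.asIdeal.map (algebraMap (𝓞 ℚ) (𝓞 K)) ≠ ⊥ := by
      rw [hmap, Ne, Ideal.span_singleton_eq_bot]; exact_mod_cast hℓ.ne_zero
    rw [← hmap, ← Ideal.IsDedekindDomain.ramificationIdx_eq_normalizedFactors_count v.asIdeal
      w.asIdeal hne]
    exact Ideal.ramificationIdx_eq_one_iff.mpr (hunr w.asIdeal w.isPrime inferInstance)
  -- ### Step G: the local criterion at `w`, for the classes `2^a c_i`
  have hloc : ∀ i (a : ℕ), (((2 : ℤ) ^ a) • cs i ∈
      (W.baseChange K).torsionLocalKer (w.adicCompletion K) ((2 ^ M : ℕ) : ℤ) ↔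
        ((2 : ℤ) ^ a) • h1Eval (W.baseChange K) ((2 ^ M : ℕ) : ℤ) (cs i)
          (ht.conjGalCMH (ρ * m) * (ρ * m)) = 0) := by
    intro i a
    haveI : CharZero (w.adicCompletion K) :=
      charZero_of_injective_algebraMap (algebraMap K (w.adicCompletion K)).injective
    obtain ⟨𝔐, h𝔐⟩ := w.localPrimesAbove_nonempty
    set 𝔓w := w.primeBelow (closureEmb (K := K) (w.adicCompletion K)) 𝔐 with h𝔓w_def
    have h𝔓w : 𝔓w ∈ w.primesAbove := w.primeBelow_mem_primesAbove h𝔐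
    obtain ⟨δ, hδ, hF⟩ :=
      HeightOneSpectrum.exists_isArithFrobAt_conj_of_mem_primesAbove_holds h𝔔w h𝔓w hτ'
    have hFT : δ * τ' * δ⁻¹ ∈ torsionFixing (W.baseChange K) ((2 ^ M : ℕ) : ℤ) :=
      (torsionFixing_normal (W.baseChange K) _).conj_mem _ hτ'T δ
    have hwbad : w ∉ (W.baseChange K).badPlaces (𝓞 K) := fun h ↦
      hvS₃ ⟨w, Or.inl h, hwv⟩
    have hwT : w ∉ T i := fun h ↦ hvS₃ ⟨w, Or.inr (Set.mem_iUnion.mpr ⟨i, h⟩), hwv⟩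
    have hpw : (((2 : ℕ) : ℤ) : 𝓞 K) ∉ w.asIdeal := by
      rw [Int.cast_natCast]
      exact not_natCast_mem_of_prime_ne hℓ hp hℓp w hℓw
    have hpMw : ((((2 ^ M : ℕ) : ℤ)) : 𝓞 K) ∉ w.asIdeal := fun h ↦ by
      apply hpw
      rw [Int.cast_natCast, Nat.cast_pow] at h
      rw [Int.cast_natCast]
      exact w.isPrime.mem_of_pow_mem M h
    have hcrit := mem_torsionLocalKer_iff_h1Eval_eq_zero (W.baseChange K) ((2 ^ M : ℕ) : ℤ) h𝔐
      hF hFT (inertia_le_torsionFixing (W.baseChange K) hwbad hpMw _ h𝔐)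
      (isOpen_torsionFixing (W.baseChange K) hn0)
      (torsionPointsMap_bijective (W.baseChange K) (w.adicCompletion K)
        (pow_ne_zero M hp.ne_zero)).2
      (AddSubgroup.zsmul_mem _ (hT i w hwT 𝔓w h𝔓w) ((2 : ℤ) ^ a))
    rw [hcrit, h1Eval_conj (W.baseChange K) _ _ δ hτ'T, smul_eq_zero_iff_eq,
      h1Eval_zsmul (W.baseChange K) _ _ _ hτ'T, hτ'eq]
  -- ### Step H: assemble; (3.2)' ⟹ (3.3) at `2^M` for the element `h₀ = c₀ · res ρ` (§E, `c₀ ↦` any `μ`-inverting element)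
  have hγK : ∀ (e : K →ₐ[ℚ] AlgebraicClosure ℚ) (x : K), (c₀ * absGaloisRestrict ℚ K g) • e x = c₀ • e x :=
    fun e x ↦ by rw [mul_smul, absGaloisRestrict_smul_apply_eq g e x]
  have hℓ2 : ℓ ≠ 2 := hℓp
  have hdvd1 : 2 ^ M ∣ ℓ + 1 :=
    pow_dvd_add_one_of_frob_smul_eq_of_inverts W hp hM hℓ hℓ2 hℓv h𝔓₀ hγ hμ key
  have hdvd2 : ((2 : ℤ) ^ M) ∣ W.frobeniusTrace ℓ := by
    have h := pow_dvd_frobeniusTraceAt_of_frob_smul_eq_of_inverts W hp hM hℓ hℓ2 hℓv hgood₀ h𝔓₀ hγ hμ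
      hsq key
    rw [W.frobeniusTraceAt_eq_frobeniusTrace v] at h
    rwa [show ((primesEquiv v : ℕ)) = ℓ from primesEquiv_eq_of_natCast_mem hℓ hℓv] at h
  refine ⟨ℓ, hbℓ, hℓ, hℓN', hℓD', hℓ2, hspan ▸ w.isPrime,
    ⟨v, 𝔓₀, c₀ * absGaloisRestrict ℚ K g, hℓv, h𝔓₀, hγ, key, hγK⟩, hdvd1, hdvd2, fun i v' hv' ↦ ?_⟩
  rw [hwuniq' v' hv']
  exact ⟨(hloc i (Nv i)).mpr (hρ m hm i).1, fun hN h ↦ (hρ m hm i).2 hN ((hloc i _).mp h)⟩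

end ChebotarevF

end Summit.BirchSwinnertonDyer.BirchSwinnertonDyer.Theorems.OffBigImageOddLocalAtTwo.Engine

end
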